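import Summits.QuantumFields.BalabanUV.Beta.CovariantKato

/-!
# `Summit.QuantumFields.BalabanUV.Beta.SubsolutionMeanValue` — road P3's REDUCTION of the local-regularity datum `hreg` (O.2 item
# (ii-b) for the MODEL) to ONE named binder: a NONNEGATIVE sub-solution of the free weighted graph Laplacian with bounded source is
# dominated at a site by «the MEAN-VALUE functional of itself + (source bound) × (any nonnegative unit supersolution)» — by pure order
# bookkeeping (positive parts), with NO Dirichlet solve, NO harmonic measure and NO comparison principle on the path

HONEST FRAMING (page 1 of everything in this cell).  Discharging `FlowStep.BetaPertH` would make Bałaban's ultraviolet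
stability UNCONDITIONAL — a constructive-QFT result; it is NOT the continuum limit and NOT the Clay problem.  This module
discharges nothing of `BetaPertH`; it is [folklore] finite order bookkeeping on a finite bond structure, kernel-checked, by CO-OWNER #3
of binder row D4 (unit `b2b-balaban-beta-d4-p3`, road P3 «reduction road», gen 12).  HONEST DEPENDENCY: continuum YM on T⁴ ⇐
BetaPertH ∧ nine spine estimates (0/9 proved); BetaPertH ⇐ (D1) ∧ (D4) ∧ CAP+tail; G-an2-4 gates asym, D1 and NE2/3/4.

THE POINT.  The row-D4 owner's census E-an4-141a decomposes the one shared analytic residual of the MODEL programme — the binder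
`hreg` of `MultiscaleSupMember.real_sup_levelOp_inverse_le_of_regularity` («|f(p)| ≤ c₁·√(n(p)^{−d}·Σ_{ball} f²) + c₂·n(p)²·sup_{ball}
|Af|») — into (P) the averaging budget (file 10a, KERNEL), (K) Kato's inequality (file 12, KERNEL), (DS) a Dirichlet solve on lattice
balls and (MV) the mean-value inequality for nonnegative free sub-harmonic functions (the XL residual), with the comparison principle
(file 14, KERNEL) as the tool.  THIS FILE shows that the path from (K) to `hreg`'s SHAPE needs LESS: writing
`W(x) = Σ_{b : tgt b = x} c_b² + Σ_{b : src b = x} c_b²` and `(Nu)(x) = Σ_{b : tgt b = x} c_b²·u(src b) + Σ_{b : src b = x} c_b²·u(tgt b)`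
on any finite bond structure `src, tgt : Bd → St` with weights `c`,

* a sub-solution `u` with source `s` on `B` (`W·u ≤ Nu + s` on `B`) minus a supersolution `g` with the same source (`Ng + s ≤ W·g`
  on `B`) is a sub-solution with ZERO source (`sub_sub_super`); the positive part of a zero-source sub-solution is a NONNEGATIVE
  zero-source sub-solution (`posPart_subsolution` — the maximum of two sub-solutions is one);
* hence (**`subsolution_le_meanValue_add`**) if `u ≥ 0` and `g ≥ 0`, then for every site `p` and every MONOTONE functional `Φ`
  satisfying the MEAN-VALUE BINDER at `(B, p)` — «every `z ≥ 0` with `W·z ≤ Nz` on `B` has `z(p) ≤ Φ(z)`» —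
  `u(p) ≤ Φ(u) + g(p)`: indeed `u − g ≤ (u − g)⁺ ≤ u` and `(MV)` applies to `(u − g)⁺`;
* with `g := m′·w₀` for ANY nonnegative `w₀` with `1 + Nw₀ ≤ W·w₀` on `B` (a unit supersolution — the (DS) OBJECT; no margin, no
  exterior domination, no uniqueness needed) and `s ≤ m′` on `B`: **`u(p) ≤ Φ(u) + m′·w₀(p)`** (`subsolution_le_meanValue_unit`);
* the binder passes from the L¹ form `Φ(z) = C·Σ_{B′} z` to the ℓ² form `C·√#B′·√(Σ_{B′} z²)` by Cauchy–Schwarz (`meanValue_l2_of_l1`);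
* (**`fibreNorm_le_meanValue`**) with file 12's `kato_covLap`, for ANY column-orthonormal bond matrices `Rm` and any field `f`: if
  `√(Σ_i ((D*Df)(x,i))²) ≤ m′` on `B`, then `√(Σ_i f(p,i)²) ≤ Φ(x ↦ √(Σ_i f(x,i)²)) + m′·w₀(p)` — `hreg`'s SHAPE for the bare
  covariant Laplacian, its first term being the mean-value functional and its second `m′ × (the supersolution at p)`
  (`≤ m′·r²/(2d·c₀²)` for the quadratic supersolution on a lattice ball of radius `r` with constant weights `c₀`); `sqrt_sum_sq_sub_le`
  serves the split `D*Df = Af − Pf` of `levelOp = D*D + P` (the (P) part joins the source).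
So, for the MODEL, O.2 item (ii-b) READS: the mean-value binder (MV) for nonnegative zero-source sub-solutions of the FREE weighted
Laplacian on the scale-adapted balls, in its weakest (L¹, at the centre) form, + the explicit supersolution; the Dirichlet solve, the
harmonic measure and the comparison principle are not on this path (file 14 remains the tool for domination ∕ uniqueness statements).
(MV) is a HYPOTHESIS here (ABSOLUTE RULE: no internally-minted fact); it is the classical interior estimate of discrete potential
theory ∕ De Giorgi–Nash–Moser on graphs — NOT in the tree, NOT proved here.

LOCATORS (shape only, nothing printed asserted; ABSOLUTE RULE): [Balaban1985BackgroundPropagators] Thm 3.1 (3.42) p. 397 (the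
sup member whose SHAPE `hreg` feeds), (3.23) p. 394 (`Δ_U = D*_U D_U`); [Balaban1983RegularityDecay] Lemma 2.2 (2.17) pp. 577–578
(print's own ℓ² → ℓ^∞ device, an L^p-improving chain — a different route to the same member).  Row D4: NO class change (critical-path
width 0; D4 DISCHARGE NO DATE); NOT BetaPertH, NOT continuum, NOT Clay, NOT summit progress.
-/

open scoped BigOperators
open Finset

namespace Summit.QuantumFields.BalabanUV.Beta.SubsolutionMeanValue

open Summit.QuantumFields.BalabanUV.Beta.CovariantKato (kato_covLap sqrt_sum_sq_add_le)
open Literature.MathematicalPhysics.QuantumFieldTheory.Balaban1983to89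
open Literature.MathematicalPhysics.QuantumFieldTheory.Balaban1983to89.B9Thm37Glue (covD covDT)

noncomputable section

variable {St Bd : Type} [Fintype Bd] [DecidableEq St] (src tgt : Bd → St) (c : Bd → ℝ)

/-! Throughout, `W(x)` abbreviates `(Σ_{b : tgt b = x} c_b²) + Σ_{b : src b = x} c_b²` and `(Nu)(x)` abbreviates
`(Σ_{b : tgt b = x} c_b²·u(src b)) + Σ_{b : src b = x} c_b²·u(tgt b)`, written out in full in every statement (the syntactic shape of
files 12∕14, so that hypotheses pass between the files by `exact`). -/

/-! ## §1 Order bookkeeping for sub- and supersolutions of the free weighted graph Laplacian -/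

/-- The neighbour sum is additive: `N(u − g) = Nu − Ng`. [folklore] -/
theorem nb_sub (u g : St → ℝ) (x : St) :
    ((∑ b ∈ univ.filter (fun b => tgt b = x), c b ^ 2 * (u (src b) - g (src b))) +
        ∑ b ∈ univ.filter (fun b => src b = x), c b ^ 2 * (u (tgt b) - g (tgt b))) =
      ((∑ b ∈ univ.filter (fun b => tgt b = x), c b ^ 2 * u (src b)) +
          ∑ b ∈ univ.filter (fun b => src b = x), c b ^ 2 * u (tgt b)) -
        ((∑ b ∈ univ.filter (fun b => tgt b = x), c b ^ 2 * g (src b)) +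
          ∑ b ∈ univ.filter (fun b => src b = x), c b ^ 2 * g (tgt b)) := by
  simp only [mul_sub, Finset.sum_sub_distrib]
  ring

/-- The neighbour sum is monotone (the weights `c_b²` are nonnegative): `u ≤ v ⟹ Nu ≤ Nv`. [folklore] -/
theorem nb_mono {u v : St → ℝ} (h : ∀ y, u y ≤ v y) (x : St) :
    ((∑ b ∈ univ.filter (fun b => tgt b = x), c b ^ 2 * u (src b)) +
        ∑ b ∈ univ.filter (fun b => src b = x), c b ^ 2 * u (tgt b)) ≤
      ((∑ b ∈ univ.filter (fun b => tgt b = x), c b ^ 2 * v (src b)) +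
        ∑ b ∈ univ.filter (fun b => src b = x), c b ^ 2 * v (tgt b)) :=
  add_le_add (Finset.sum_le_sum fun _ _ => mul_le_mul_of_nonneg_left (h _) (sq_nonneg _))
    (Finset.sum_le_sum fun _ _ => mul_le_mul_of_nonneg_left (h _) (sq_nonneg _))

/-- The neighbour sum of a nonnegative function is nonnegative. [folklore] -/
theorem nb_nonneg {u : St → ℝ} (h : ∀ y, 0 ≤ u y) (x : St) :
    0 ≤ ((∑ b ∈ univ.filter (fun b => tgt b = x), c b ^ 2 * u (src b)) +
      ∑ b ∈ univ.filter (fun b => src b = x), c b ^ 2 * u (tgt b)) :=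
  add_nonneg (Finset.sum_nonneg fun _ _ => mul_nonneg (sq_nonneg _) (h _))
    (Finset.sum_nonneg fun _ _ => mul_nonneg (sq_nonneg _) (h _))

/-- The neighbour sum is homogeneous: `N(a·w) = a·Nw`. [folklore] -/
theorem nb_smul (a : ℝ) (w : St → ℝ) (x : St) :
    ((∑ b ∈ univ.filter (fun b => tgt b = x), c b ^ 2 * (a * w (src b))) +
        ∑ b ∈ univ.filter (fun b => src b = x), c b ^ 2 * (a * w (tgt b))) =
      a * ((∑ b ∈ univ.filter (fun b => tgt b = x), c b ^ 2 * w (src b)) +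
        ∑ b ∈ univ.filter (fun b => src b = x), c b ^ 2 * w (tgt b)) := by
  simp only [mul_add, Finset.mul_sum]
  congr 1 <;> exact Finset.sum_congr rfl fun b _ => by ring

/-- **Sub minus super is sub.**  If `W·u ≤ Nu + s` on `B` (sub-solution with source `s`) and `Ng + s ≤ W·g` on `B` (supersolution
with the same source), then `v = u − g` satisfies `W·v ≤ Nv` on `B`. [folklore] -/
theorem sub_sub_super (B : Finset St) (u g s : St → ℝ)
    (hsub : ∀ x ∈ B, ((∑ b ∈ univ.filter (fun b => tgt b = x), c b ^ 2) + ∑ b ∈ univ.filter (fun b => src b = x), c b ^ 2) * u x ≤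
      ((∑ b ∈ univ.filter (fun b => tgt b = x), c b ^ 2 * u (src b)) + ∑ b ∈ univ.filter (fun b => src b = x), c b ^ 2 * u (tgt b))
        + s x)
    (hsup : ∀ x ∈ B, ((∑ b ∈ univ.filter (fun b => tgt b = x), c b ^ 2 * g (src b)) +
        ∑ b ∈ univ.filter (fun b => src b = x), c b ^ 2 * g (tgt b)) + s x ≤
      ((∑ b ∈ univ.filter (fun b => tgt b = x), c b ^ 2) + ∑ b ∈ univ.filter (fun b => src b = x), c b ^ 2) * g x) :
    ∀ x ∈ B, ((∑ b ∈ univ.filter (fun b => tgt b = x), c b ^ 2) + ∑ b ∈ univ.filter (fun b => src b = x), c b ^ 2) * (u x - g x) ≤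
      ((∑ b ∈ univ.filter (fun b => tgt b = x), c b ^ 2 * (u (src b) - g (src b))) +
        ∑ b ∈ univ.filter (fun b => src b = x), c b ^ 2 * (u (tgt b) - g (tgt b))) := by
  intro x hx
  rw [nb_sub src tgt c u g x, mul_sub]
  have h1 := hsub x hx
  have h2 := hsup x hx
  linarith

/-- **The positive part of a zero-source sub-solution is a (nonnegative) zero-source sub-solution** — the maximum of the two
sub-solutions `v` and `0`: where `v(x) ≤ 0` the left side vanishes and `N(v⁺) ≥ 0`; where `v(x) > 0`,
`W·v⁺(x) = W·v(x) ≤ Nv(x) ≤ N(v⁺)(x)` by monotonicity. [folklore] -/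
theorem posPart_subsolution (B : Finset St) (v : St → ℝ)
    (hv : ∀ x ∈ B, ((∑ b ∈ univ.filter (fun b => tgt b = x), c b ^ 2) + ∑ b ∈ univ.filter (fun b => src b = x), c b ^ 2) * v x ≤
      ((∑ b ∈ univ.filter (fun b => tgt b = x), c b ^ 2 * v (src b)) + ∑ b ∈ univ.filter (fun b => src b = x), c b ^ 2 * v (tgt b))) :
    ∀ x ∈ B, ((∑ b ∈ univ.filter (fun b => tgt b = x), c b ^ 2) + ∑ b ∈ univ.filter (fun b => src b = x), c b ^ 2) * max (v x) 0 ≤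
      ((∑ b ∈ univ.filter (fun b => tgt b = x), c b ^ 2 * max (v (src b)) 0) +
        ∑ b ∈ univ.filter (fun b => src b = x), c b ^ 2 * max (v (tgt b)) 0) := by
  intro x hx
  have hmono := nb_mono src tgt c (u := v) (v := fun y => max (v y) 0) (fun y => le_max_left (v y) 0) x
  have hnn := nb_nonneg src tgt c (u := fun y => max (v y) 0) (fun y => le_max_right (v y) 0) x
  by_cases h : v x ≤ 0
  · rw [max_eq_right h, mul_zero]
    exact hnn
  · rw [max_eq_left (le_of_lt (lt_of_not_ge h))]
    exact (hv x hx).trans hmono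

/-- A nonnegative UNIT supersolution scales to a supersolution with any constant source `m′ ≥ 0` dominating `s`:
`1 + Nw₀ ≤ W·w₀` on `B`, `s ≤ m′` on `B` ⟹ `N(m′w₀) + s ≤ W·(m′w₀)` on `B`. [folklore] -/
theorem unit_supersolution_smul (B : Finset St) (w₀ s : St → ℝ) {m' : ℝ} (hm' : 0 ≤ m')
    (hw₀ : ∀ x ∈ B, 1 + ((∑ b ∈ univ.filter (fun b => tgt b = x), c b ^ 2 * w₀ (src b)) +
        ∑ b ∈ univ.filter (fun b => src b = x), c b ^ 2 * w₀ (tgt b)) ≤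
      ((∑ b ∈ univ.filter (fun b => tgt b = x), c b ^ 2) + ∑ b ∈ univ.filter (fun b => src b = x), c b ^ 2) * w₀ x)
    (hs : ∀ x ∈ B, s x ≤ m') :
    ∀ x ∈ B, ((∑ b ∈ univ.filter (fun b => tgt b = x), c b ^ 2 * (m' * w₀ (src b))) +
        ∑ b ∈ univ.filter (fun b => src b = x), c b ^ 2 * (m' * w₀ (tgt b))) + s x ≤
      ((∑ b ∈ univ.filter (fun b => tgt b = x), c b ^ 2) + ∑ b ∈ univ.filter (fun b => src b = x), c b ^ 2) * (m' * w₀ x) := by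
  intro x hx
  rw [nb_smul src tgt c m' w₀ x]
  have h1 := mul_le_mul_of_nonneg_left (hw₀ x hx) hm'
  have h2 := hs x hx
  have h3 : ((∑ b ∈ univ.filter (fun b => tgt b = x), c b ^ 2) + ∑ b ∈ univ.filter (fun b => src b = x), c b ^ 2) * (m' * w₀ x) =
      m' * (((∑ b ∈ univ.filter (fun b => tgt b = x), c b ^ 2) + ∑ b ∈ univ.filter (fun b => src b = x), c b ^ 2) * w₀ x) := by
    ring
  rw [h3]
  linarith

/-! ## §2 THE REDUCTION: sub-solution ≤ mean-value functional + supersolution -/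

/-- **SUB-SOLUTION ≤ MEAN VALUE + SUPERSOLUTION.**  On a finite bond structure with weights `c`, let `B` be a finite set of sites
and `p` a site; let `Φ` be a functional on site functions, MONOTONE on nonnegative functions, satisfying the MEAN-VALUE BINDER at
`(B, p)`: every `z ≥ 0` with `W·z ≤ Nz` on `B` (a nonnegative zero-source sub-solution of the free weighted Laplacian on `B`, its
values off `B` free) has `z(p) ≤ Φ(z)`.  If `u ≥ 0` is a sub-solution with source `s` on `B` (`W·u ≤ Nu + s`) and `g ≥ 0` a
supersolution with the same source on `B` (`Ng + s ≤ W·g`), then `u(p) ≤ Φ(u) + g(p)`.  Proof: `v = u − g` is a zero-source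
sub-solution (`sub_sub_super`), `v⁺` a nonnegative one (`posPart_subsolution`), `(MV)` gives `v⁺(p) ≤ Φ(v⁺) ≤ Φ(u)` as
`0 ≤ v⁺ ≤ u`, and `u(p) = v(p) + g(p) ≤ v⁺(p) + g(p)`.  No Dirichlet solve, harmonic measure or comparison principle is used.
[folklore] -/
theorem subsolution_le_meanValue_add (B : Finset St) (p : St) (Φ : (St → ℝ) → ℝ)
    (hΦ : ∀ z z' : St → ℝ, (∀ y, 0 ≤ z y) → (∀ y, z y ≤ z' y) → Φ z ≤ Φ z')
    (hMV : ∀ z : St → ℝ, (∀ y, 0 ≤ z y) →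
      (∀ x ∈ B, ((∑ b ∈ univ.filter (fun b => tgt b = x), c b ^ 2) + ∑ b ∈ univ.filter (fun b => src b = x), c b ^ 2) * z x ≤
        ((∑ b ∈ univ.filter (fun b => tgt b = x), c b ^ 2 * z (src b)) + ∑ b ∈ univ.filter (fun b => src b = x), c b ^ 2 * z (tgt b))) →
      z p ≤ Φ z)
    (u g s : St → ℝ) (hu0 : ∀ y, 0 ≤ u y) (hg0 : ∀ y, 0 ≤ g y)
    (hsub : ∀ x ∈ B, ((∑ b ∈ univ.filter (fun b => tgt b = x), c b ^ 2) + ∑ b ∈ univ.filter (fun b => src b = x), c b ^ 2) * u x ≤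
      ((∑ b ∈ univ.filter (fun b => tgt b = x), c b ^ 2 * u (src b)) + ∑ b ∈ univ.filter (fun b => src b = x), c b ^ 2 * u (tgt b))
        + s x)
    (hsup : ∀ x ∈ B, ((∑ b ∈ univ.filter (fun b => tgt b = x), c b ^ 2 * g (src b)) +
        ∑ b ∈ univ.filter (fun b => src b = x), c b ^ 2 * g (tgt b)) + s x ≤
      ((∑ b ∈ univ.filter (fun b => tgt b = x), c b ^ 2) + ∑ b ∈ univ.filter (fun b => src b = x), c b ^ 2) * g x) :
    u p ≤ Φ u + g p := by
  have hv := sub_sub_super src tgt c B u g s hsub hsup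
  have hvp := posPart_subsolution src tgt c B (fun y => u y - g y) hv
  have hz0 : ∀ y, 0 ≤ max (u y - g y) 0 := fun y => le_max_right _ _
  have hzu : ∀ y, max (u y - g y) 0 ≤ u y := fun y => max_le (by linarith [hg0 y]) (hu0 y)
  have h1 : max (u p - g p) 0 ≤ Φ (fun y => max (u y - g y) 0) := hMV _ hz0 hvp
  have h2 : Φ (fun y => max (u y - g y) 0) ≤ Φ u := hΦ _ _ hz0 hzu
  have h3 : u p - g p ≤ max (u p - g p) 0 := le_max_left _ _
  linarith

/-- **SUB-SOLUTION ≤ MEAN VALUE + m′ × UNIT SUPERSOLUTION.**  As `subsolution_le_meanValue_add`, with `g = m′·w₀` for ANY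
nonnegative `w₀` with `1 + Nw₀ ≤ W·w₀` on `B` (a unit supersolution — on a lattice ball of radius `r` with constant weights `c₀`
the quadratic `(r² − |x − x₀|²)/(2d·c₀²)` is one) and a bound `s ≤ m′` (`m′ ≥ 0`) of the source on `B`:
`u(p) ≤ Φ(u) + m′·w₀(p)` — `hreg`'s two terms, the mean-value functional and `m′ × (the supersolution at p)`. [folklore] -/
theorem subsolution_le_meanValue_unit (B : Finset St) (p : St) (Φ : (St → ℝ) → ℝ)
    (hΦ : ∀ z z' : St → ℝ, (∀ y, 0 ≤ z y) → (∀ y, z y ≤ z' y) → Φ z ≤ Φ z')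
    (hMV : ∀ z : St → ℝ, (∀ y, 0 ≤ z y) →
      (∀ x ∈ B, ((∑ b ∈ univ.filter (fun b => tgt b = x), c b ^ 2) + ∑ b ∈ univ.filter (fun b => src b = x), c b ^ 2) * z x ≤
        ((∑ b ∈ univ.filter (fun b => tgt b = x), c b ^ 2 * z (src b)) + ∑ b ∈ univ.filter (fun b => src b = x), c b ^ 2 * z (tgt b))) →
      z p ≤ Φ z)
    (w₀ : St → ℝ) (hw₀0 : ∀ y, 0 ≤ w₀ y)
    (hw₀ : ∀ x ∈ B, 1 + ((∑ b ∈ univ.filter (fun b => tgt b = x), c b ^ 2 * w₀ (src b)) +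
        ∑ b ∈ univ.filter (fun b => src b = x), c b ^ 2 * w₀ (tgt b)) ≤
      ((∑ b ∈ univ.filter (fun b => tgt b = x), c b ^ 2) + ∑ b ∈ univ.filter (fun b => src b = x), c b ^ 2) * w₀ x)
    (u s : St → ℝ) (hu0 : ∀ y, 0 ≤ u y) {m' : ℝ} (hm' : 0 ≤ m') (hs : ∀ x ∈ B, s x ≤ m')
    (hsub : ∀ x ∈ B, ((∑ b ∈ univ.filter (fun b => tgt b = x), c b ^ 2) + ∑ b ∈ univ.filter (fun b => src b = x), c b ^ 2) * u x ≤
      ((∑ b ∈ univ.filter (fun b => tgt b = x), c b ^ 2 * u (src b)) + ∑ b ∈ univ.filter (fun b => src b = x), c b ^ 2 * u (tgt b))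
        + s x) :
    u p ≤ Φ u + m' * w₀ p :=
  subsolution_le_meanValue_add src tgt c B p Φ hΦ hMV u (fun y => m' * w₀ y) s hu0
    (fun y => mul_nonneg hm' (hw₀0 y)) hsub (unit_supersolution_smul src tgt c B w₀ s hm' hw₀ hs)

/-! ## §3 The two standard mean-value functionals -/

omit [DecidableEq St] in
/-- The L¹ functional `Φ(z) = C·Σ_{x ∈ B′} z(x)` (`C ≥ 0`) is monotone on nonnegative functions. [folklore] -/
theorem mono_l1 (B' : Finset St) {C : ℝ} (hC : 0 ≤ C) (z z' : St → ℝ) (_hz : ∀ y, 0 ≤ z y) (h : ∀ y, z y ≤ z' y) :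
    C * ∑ x ∈ B', z x ≤ C * ∑ x ∈ B', z' x :=
  mul_le_mul_of_nonneg_left (Finset.sum_le_sum fun x _ => h x) hC

omit [DecidableEq St] in
/-- The ℓ² functional `Φ(z) = C·√(Σ_{x ∈ B′} z(x)²)` (`C ≥ 0`) is monotone on nonnegative functions. [folklore] -/
theorem mono_l2 (B' : Finset St) {C : ℝ} (hC : 0 ≤ C) (z z' : St → ℝ) (hz : ∀ y, 0 ≤ z y) (h : ∀ y, z y ≤ z' y) :
    C * Real.sqrt (∑ x ∈ B', z x ^ 2) ≤ C * Real.sqrt (∑ x ∈ B', z' x ^ 2) :=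
  mul_le_mul_of_nonneg_left (Real.sqrt_le_sqrt (Finset.sum_le_sum fun x _ =>
    pow_le_pow_left₀ (hz x) (h x) 2)) hC

/-- **From the L¹ mean-value binder to the ℓ² one by Cauchy–Schwarz**: `Σ_{B′} z ≤ √#B′·√(Σ_{B′} z²)`, so a binder with
`Φ(z) = C·Σ_{B′} z` yields the binder with `Φ(z) = C·√#B′·√(Σ_{B′} z²)` (for a lattice ball `#B′ ≍ r^d`, so `C ≍ r^{−d}` becomes
`≍ √(r^{−d}·Σ z²)` — `hreg`'s first term). [folklore] -/
theorem meanValue_l2_of_l1 (B B' : Finset St) (p : St) {C : ℝ} (hC : 0 ≤ C)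
    (hMV : ∀ z : St → ℝ, (∀ y, 0 ≤ z y) →
      (∀ x ∈ B, ((∑ b ∈ univ.filter (fun b => tgt b = x), c b ^ 2) + ∑ b ∈ univ.filter (fun b => src b = x), c b ^ 2) * z x ≤
        ((∑ b ∈ univ.filter (fun b => tgt b = x), c b ^ 2 * z (src b)) + ∑ b ∈ univ.filter (fun b => src b = x), c b ^ 2 * z (tgt b))) →
      z p ≤ C * ∑ x ∈ B', z x)
    (z : St → ℝ) (hz : ∀ y, 0 ≤ z y)
    (hzs : ∀ x ∈ B, ((∑ b ∈ univ.filter (fun b => tgt b = x), c b ^ 2) + ∑ b ∈ univ.filter (fun b => src b = x), c b ^ 2) * z x ≤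
      ((∑ b ∈ univ.filter (fun b => tgt b = x), c b ^ 2 * z (src b)) + ∑ b ∈ univ.filter (fun b => src b = x), c b ^ 2 * z (tgt b))) :
    z p ≤ C * Real.sqrt (B'.card) * Real.sqrt (∑ x ∈ B', z x ^ 2) := by
  have h1 := hMV z hz hzs
  have hcs : ∑ x ∈ B', z x ≤ Real.sqrt (B'.card) * Real.sqrt (∑ x ∈ B', z x ^ 2) := by
    have h := Finset.sum_mul_sq_le_sq_mul_sq B' (fun _ => (1 : ℝ)) z
    simp only [one_pow, one_mul, Finset.sum_const, nsmul_eq_mul, mul_one] at h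
    have h0 : 0 ≤ ∑ x ∈ B', z x := Finset.sum_nonneg fun x _ => hz x
    rw [← Real.sqrt_mul (Nat.cast_nonneg _), ← Real.sqrt_sq h0]
    exact Real.sqrt_le_sqrt h
  calc z p ≤ C * ∑ x ∈ B', z x := h1
    _ ≤ C * (Real.sqrt (B'.card) * Real.sqrt (∑ x ∈ B', z x ^ 2)) := mul_le_mul_of_nonneg_left hcs hC
    _ = _ := by ring

/-! ## §4 The fibre-norm END over Kato (file 12): `hreg`'s SHAPE for the bare covariant Laplacian -/

/-- Minkowski for a difference: `√(Σ_i (a_i − b_i)²) ≤ √(Σ_i a_i²) + √(Σ_i b_i²)` — serves the split `D*Df = Af − Pf` of the source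
when `A = D*D + P` (`levelOp`). [folklore] -/
theorem sqrt_sum_sq_sub_le {Cp : Type} [Fintype Cp] (a b : Cp → ℝ) :
    Real.sqrt (∑ i, (a i - b i) ^ 2) ≤ Real.sqrt (∑ i, a i ^ 2) + Real.sqrt (∑ i, b i ^ 2) := by
  have h := sqrt_sum_sq_add_le a (fun i => -b i)
  simp only [neg_sq, ← sub_eq_add_neg] at h
  exact h

/-- **THE FIBRE NORM OF A FIELD ≤ MEAN VALUE + (sup of ‖D*Df‖) × SUPERSOLUTION — `hreg`'s SHAPE for `D*D = covDT ∘ covD` with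
ARBITRARY column-orthonormal bond matrices.**  Let `Rm` satisfy `Σ_k R_{ki}R_{kj} = δ_{ij}` on every bond, `f : St × Cp → ℝ`,
`B` a finite set of sites, `p` a site, `w₀ ≥ 0` a unit supersolution on `B` (`1 + Nw₀ ≤ W·w₀`), `m′ ≥ 0` with
`√(Σ_i ((D*Df)(x,i))²) ≤ m′` for `x ∈ B`, and `Φ` a monotone functional satisfying the mean-value binder at `(B, p)` (every
`z ≥ 0` with `W·z ≤ Nz` on `B` has `z(p) ≤ Φ(z)`).  Then `√(Σ_i f(p,i)²) ≤ Φ(x ↦ √(Σ_i f(x,i)²)) + m′·w₀(p)`.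
Kato (file 12) makes the fibre norm a sub-solution with source `‖D*Df‖`; §2 does the rest.
[cite: Balaban1985BackgroundPropagators, (3.23) p.394 + Thm 3.1 (3.42) p.397] [folklore] -/
theorem fibreNorm_le_meanValue {Cp : Type} [Fintype Cp] [DecidableEq Cp] (Rm : Bd → Cp → Cp → ℝ)
    (hRm : ∀ b i j, ∑ k, Rm b k i * Rm b k j = if i = j then (1 : ℝ) else 0) (f : St × Cp → ℝ)
    (B : Finset St) (p : St) (Φ : (St → ℝ) → ℝ)
    (hΦ : ∀ z z' : St → ℝ, (∀ y, 0 ≤ z y) → (∀ y, z y ≤ z' y) → Φ z ≤ Φ z')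
    (hMV : ∀ z : St → ℝ, (∀ y, 0 ≤ z y) →
      (∀ x ∈ B, ((∑ b ∈ univ.filter (fun b => tgt b = x), c b ^ 2) + ∑ b ∈ univ.filter (fun b => src b = x), c b ^ 2) * z x ≤
        ((∑ b ∈ univ.filter (fun b => tgt b = x), c b ^ 2 * z (src b)) + ∑ b ∈ univ.filter (fun b => src b = x), c b ^ 2 * z (tgt b))) →
      z p ≤ Φ z)
    (w₀ : St → ℝ) (hw₀0 : ∀ y, 0 ≤ w₀ y)
    (hw₀ : ∀ x ∈ B, 1 + ((∑ b ∈ univ.filter (fun b => tgt b = x), c b ^ 2 * w₀ (src b)) +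
        ∑ b ∈ univ.filter (fun b => src b = x), c b ^ 2 * w₀ (tgt b)) ≤
      ((∑ b ∈ univ.filter (fun b => tgt b = x), c b ^ 2) + ∑ b ∈ univ.filter (fun b => src b = x), c b ^ 2) * w₀ x)
    {m' : ℝ} (hm' : 0 ≤ m')
    (hsrc : ∀ x ∈ B, Real.sqrt (∑ i, (covDT src tgt c Rm (covD src tgt c Rm f) (x, i)) ^ 2) ≤ m') :
    Real.sqrt (∑ i, f (p, i) ^ 2) ≤ Φ (fun x => Real.sqrt (∑ i, f (x, i) ^ 2)) + m' * w₀ p :=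
  subsolution_le_meanValue_unit src tgt c B p Φ hΦ hMV w₀ hw₀0 hw₀ (fun x => Real.sqrt (∑ i, f (x, i) ^ 2))
    (fun x => Real.sqrt (∑ i, (covDT src tgt c Rm (covD src tgt c Rm f) (x, i)) ^ 2)) (fun y => Real.sqrt_nonneg _) hm' hsrc
    (fun x _ => by
      have hk := kato_covLap src tgt c Rm hRm f x
      linarith)

/-- **The same with the two standard terms written out**: under the L¹ mean-value binder with constant `C ≥ 0` over a finite set
`B′` (every `z ≥ 0` with `W·z ≤ Nz` on `B` has `z(p) ≤ C·Σ_{B′} z`), for every field `f` with `√(Σ_i ((D*Df)(x,i))²) ≤ m′` on `B`: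
`√(Σ_i f(p,i)²) ≤ C·√#B′·√(Σ_{x ∈ B′} Σ_i f(x,i)²) + m′·w₀(p)` — the ℓ² first term of `hreg` (`Σ_{x∈B′}Σ_i f(x,i)²` is the field's
ℓ² mass on `B′`) and its second term `m′ × supersolution`. [cite: Balaban1985BackgroundPropagators, Thm 3.1 (3.42) p.397] [folklore] -/
theorem fibreNorm_le_l2_add {Cp : Type} [Fintype Cp] [DecidableEq Cp] (Rm : Bd → Cp → Cp → ℝ)
    (hRm : ∀ b i j, ∑ k, Rm b k i * Rm b k j = if i = j then (1 : ℝ) else 0) (f : St × Cp → ℝ)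
    (B B' : Finset St) (p : St) {C : ℝ} (hC : 0 ≤ C)
    (hMV : ∀ z : St → ℝ, (∀ y, 0 ≤ z y) →
      (∀ x ∈ B, ((∑ b ∈ univ.filter (fun b => tgt b = x), c b ^ 2) + ∑ b ∈ univ.filter (fun b => src b = x), c b ^ 2) * z x ≤
        ((∑ b ∈ univ.filter (fun b => tgt b = x), c b ^ 2 * z (src b)) + ∑ b ∈ univ.filter (fun b => src b = x), c b ^ 2 * z (tgt b))) →
      z p ≤ C * ∑ x ∈ B', z x)
    (w₀ : St → ℝ) (hw₀0 : ∀ y, 0 ≤ w₀ y)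
    (hw₀ : ∀ x ∈ B, 1 + ((∑ b ∈ univ.filter (fun b => tgt b = x), c b ^ 2 * w₀ (src b)) +
        ∑ b ∈ univ.filter (fun b => src b = x), c b ^ 2 * w₀ (tgt b)) ≤
      ((∑ b ∈ univ.filter (fun b => tgt b = x), c b ^ 2) + ∑ b ∈ univ.filter (fun b => src b = x), c b ^ 2) * w₀ x)
    {m' : ℝ} (hm' : 0 ≤ m')
    (hsrc : ∀ x ∈ B, Real.sqrt (∑ i, (covDT src tgt c Rm (covD src tgt c Rm f) (x, i)) ^ 2) ≤ m') :
    Real.sqrt (∑ i, f (p, i) ^ 2) ≤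
      C * Real.sqrt (B'.card) * Real.sqrt (∑ x ∈ B', ∑ i, f (x, i) ^ 2) + m' * w₀ p := by
  have hMV2 := meanValue_l2_of_l1 src tgt c B B' p hC hMV
  have h := fibreNorm_le_meanValue src tgt c Rm hRm f B p
    (fun z => C * Real.sqrt (B'.card) * Real.sqrt (∑ x ∈ B', z x ^ 2))
    (fun z z' hz h => mono_l2 B' (mul_nonneg hC (Real.sqrt_nonneg (B'.card : ℝ))) z z' hz h)
    (fun z hz hzs => hMV2 z hz hzs) w₀ hw₀0 hw₀ hm' hsrc
  have hsq : ∀ x, Real.sqrt (∑ i, f (x, i) ^ 2) ^ 2 = ∑ i, f (x, i) ^ 2 := fun x =>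
    Real.sq_sqrt (Finset.sum_nonneg fun i _ => sq_nonneg _)
  simp only [hsq] at h
  exact h

/-! ## §5 Witness (non-vacuity): one bond `false → true` with weight 1, `B = {true}`, `p = true` -/

/-- WITNESS.  Two sites, one bond `false → true` of weight `1`, `B = {true}`: `W(true) = 1`, `(Nu)(true) = u(false)`; the unit
supersolution `w₀ = (false ↦ 0, true ↦ 1)`; the mean-value binder holds with `Φ(z) = z(false)` (a nonnegative zero-source
sub-solution has `z(true) ≤ z(false)`); and §2 returns `u(true) ≤ u(false) + m′` for every `u ≥ 0` with `u(true) ≤ u(false) + m′`.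
[folklore] -/
example (u : Bool → ℝ) (hu0 : ∀ y, 0 ≤ u y) {m' : ℝ} (hm' : 0 ≤ m') (hu : u true ≤ u false + m') :
    u true ≤ u false + m' * 1 := by
  have key := subsolution_le_meanValue_unit (St := Bool) (Bd := Unit) (fun _ => false) (fun _ => true) (fun _ => (1 : ℝ))
    {true} true (fun z => z false) (fun z z' _ h => h false)
    (fun z _ hz => by
      have h := hz true (Finset.mem_singleton_self _)
      simpa using h)
    (fun y => if y then 1 else 0) (fun y => by cases y <;> simp)
    (fun x hx => by
      rw [Finset.mem_singleton] at hx
      subst hx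
      simp)
    u (fun _ => m') hu0 hm' (fun _ _ => le_rfl)
    (fun x hx => by
      rw [Finset.mem_singleton] at hx
      subst hx
      simpa using hu)
  simpa using key

end

end Summit.QuantumFields.BalabanUV.Beta.SubsolutionMeanValue
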